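import Mathlib
import HarnessLib

/-!
# PF-persistence mechanism lemma: the exact secular law of a planted central zero

pub-rhpf THEORY-4 §7.14 (mechanism / rigidity campaign; **no RH claims**; this file is
kernel-checked linear algebra, labelled PROVED; every number quoted from the observatory
elsewhere is DATA).

A central zero of order `r` of an L-function contributes the RANK-ONE term
`r · |∫ f|² = r · L · (v 0)²` to the even Weil form of the window `[-L/2, L/2]`
(`integral_profile` in `PfPersistenceCentralMassFloor`): the perturbed form is
`Q + lam · e₀ e₀ᵀ` with `lam = r · L` and `e₀` the constant mode.  In the eigenbasis
`u₁, …, u_n` of `Q` (levels `ε k`) write `p k = ⟪u_k, e₀⟫` and let `w` be the coordinates of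
an eigenvector of the perturbed form at energy `e`; the eigen-equation is
`ε k * w k + lam * (p ⬝ᵥ w) * p k = e * w k` (`IsSecularEigenpair`).  Then, whenever `e` is
not one of the unperturbed levels and the eigenvector is not orthogonal to `e₀`
(`p ⬝ᵥ w ≠ 0`, automatic for the perturbed ground state of a critical object):

* `component`        : `w k = lam * (p ⬝ᵥ w) * p k / (e - ε k)`;
* `secular_equation` : `lam * ∑ k, p k ^ 2 / (e - ε k) = 1`;
* `norm_sq`          : `w ⬝ᵥ w = (lam * (p ⬝ᵥ w)) ^ 2 * ∑ k, p k ^ 2 / (e - ε k) ^ 2`;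
* `centralMass_law`  : `|p ⬝ᵥ w| / √(w ⬝ᵥ w) = 1 / (lam * √(∑ k, p k ^ 2 / (e - ε k) ^ 2))`
  — since `p ⬝ᵥ w` is the `e₀`-coordinate `v 0` of the eigenvector, the central mass
  `m = |v 0| · √L / ‖v‖` of `PfPersistenceCentralMassFloor.centralMass` equals
  `√L / (lam · √(∑ p_k² / (e - ε_k)²))` EXACTLY (all levels, no truncation); the two-level
  truncation is `PfPersistenceTwoLevelCentralMass.twoLevelCentralMassLaw`, i.e. the
  dictionary `C := m / e ≈ tan ψ / (r · p · √L)` of THEORY-4 §7.2;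
* `exists_level_below` : for `lam > 0` some unperturbed level with `p k ≠ 0` lies strictly
  below `e` (the planted energy cannot sit under the whole frame it couples to).
-/

set_option linter.dupNamespace false  -- the mandated namespace repeats `RiemannHypothesis`

namespace Summit.RiemannHypothesis.RiemannHypothesis.Theorems.PfPersistence.SecularLaw

open Matrix Finset

variable {n : ℕ}

/-- Eigen-equation of the diagonal-plus-rank-one model `diag(ε) + lam · p pᵀ` at energy `e`
with eigenvector coordinates `w` (the planted-central-zero form in the unperturbed eigenbasis). -/
def IsSecularEigenpair (ε p : Fin n → ℝ) (lam e : ℝ) (w : Fin n → ℝ) : Prop :=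
  ∀ k, ε k * w k + lam * (p ⬝ᵥ w) * p k = e * w k

variable {ε p w : Fin n → ℝ} {lam e : ℝ}

/-- PROVED: each coordinate of the perturbed eigenvector is the coupling profile divided by the
level detuning. -/
theorem component (h : IsSecularEigenpair ε p lam e w) (hne : ∀ k, ε k ≠ e) (k : Fin n) :
    w k = lam * (p ⬝ᵥ w) * p k / (e - ε k) := by
  have hk := h k
  have hden : e - ε k ≠ 0 := sub_ne_zero.mpr fun h' => hne k h'.symm
  rw [eq_div_iff hden]
  linear_combination (-1 : ℝ) * hk

/-- PROVED (the secular equation): `lam * ∑ p_k² / (e - ε_k) = 1`. -/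
theorem secular_equation (h : IsSecularEigenpair ε p lam e w) (hne : ∀ k, ε k ≠ e)
    (hpw : p ⬝ᵥ w ≠ 0) : lam * ∑ k, p k ^ 2 / (e - ε k) = 1 := by
  have key : p ⬝ᵥ w = (p ⬝ᵥ w) * (lam * ∑ k, p k ^ 2 / (e - ε k)) := by
    calc p ⬝ᵥ w = ∑ k, p k * w k := rfl
      _ = ∑ k, p k * (lam * (p ⬝ᵥ w) * p k / (e - ε k)) := by
          refine Finset.sum_congr rfl fun k _ => ?_
          rw [← component h hne k]
      _ = (p ⬝ᵥ w) * (lam * ∑ k, p k ^ 2 / (e - ε k)) := by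
          rw [Finset.mul_sum, Finset.mul_sum]
          refine Finset.sum_congr rfl fun k _ => ?_
          ring
  have h2 : (p ⬝ᵥ w) * (lam * ∑ k, p k ^ 2 / (e - ε k) - 1) = 0 := by
    linear_combination (-1 : ℝ) * key
  have h3 := (mul_eq_zero.mp h2).resolve_left hpw
  linarith

/-- PROVED: the squared norm of the perturbed eigenvector in terms of the coupling profile. -/
theorem norm_sq (h : IsSecularEigenpair ε p lam e w) (hne : ∀ k, ε k ≠ e) :
    w ⬝ᵥ w = (lam * (p ⬝ᵥ w)) ^ 2 * ∑ k, p k ^ 2 / (e - ε k) ^ 2 := by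
  calc w ⬝ᵥ w = ∑ k, w k * w k := rfl
    _ = ∑ k, (lam * (p ⬝ᵥ w) * p k / (e - ε k)) * (lam * (p ⬝ᵥ w) * p k / (e - ε k)) := by
        refine Finset.sum_congr rfl fun k _ => ?_
        rw [← component h hne k]
    _ = (lam * (p ⬝ᵥ w)) ^ 2 * ∑ k, p k ^ 2 / (e - ε k) ^ 2 := by
        rw [Finset.mul_sum]
        refine Finset.sum_congr rfl fun k _ => ?_
        have hden : e - ε k ≠ 0 := sub_ne_zero.mpr fun h' => hne k h'.symm
        rw [div_mul_div_comm, mul_div_assoc']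
        congr 1 <;> ring

/-- PROVED (exact central-mass law, all levels): `|p ⬝ᵥ w| / √(w ⬝ᵥ w) = 1 / (lam · √(∑ p_k²/(e-ε_k)²))`.
With `p ⬝ᵥ w = v 0` (the `e₀`-coordinate) this is `centralMass L v = √L / (lam · √(∑ …))`. -/
theorem centralMass_law (h : IsSecularEigenpair ε p lam e w) (hne : ∀ k, ε k ≠ e)
    (hpw : p ⬝ᵥ w ≠ 0) (hlam : 0 < lam) :
    |p ⬝ᵥ w| / Real.sqrt (w ⬝ᵥ w) =
      1 / (lam * Real.sqrt (∑ k, p k ^ 2 / (e - ε k) ^ 2)) := by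
  set S := ∑ k, p k ^ 2 / (e - ε k) ^ 2 with hS
  have hS0 : 0 ≤ S := Finset.sum_nonneg fun k _ => div_nonneg (sq_nonneg _) (sq_nonneg _)
  have hww : w ⬝ᵥ w = (lam * (p ⬝ᵥ w)) ^ 2 * S := norm_sq h hne
  have hw0 : w ≠ 0 := by
    rintro rfl
    exact hpw (by simp)
  have hwwpos : 0 < w ⬝ᵥ w := by
    obtain ⟨k, hk⟩ := Function.ne_iff.mp hw0
    calc (0 : ℝ) < w k * w k := mul_self_pos.mpr hk
      _ ≤ ∑ j, w j * w j :=
          Finset.single_le_sum (f := fun j => w j * w j) (fun j _ => mul_self_nonneg (w j))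
            (Finset.mem_univ k)
      _ = w ⬝ᵥ w := rfl
  have hSpos : 0 < S := by
    rcases lt_or_eq_of_le hS0 with hlt | heq
    · exact hlt
    · exfalso
      rw [hww, ← heq, mul_zero] at hwwpos
      exact lt_irrefl _ hwwpos
  have hsq : Real.sqrt (w ⬝ᵥ w) = lam * |p ⬝ᵥ w| * Real.sqrt S := by
    rw [hww, Real.sqrt_mul (sq_nonneg _), Real.sqrt_sq_eq_abs, abs_mul, abs_of_pos hlam]
  rw [hsq]
  have hpw' : 0 < |p ⬝ᵥ w| := abs_pos.mpr hpw
  have hSs : 0 < Real.sqrt S := Real.sqrt_pos.mpr hSpos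
  field_simp

/-- PROVED: for a positive planting strength some coupled unperturbed level lies strictly below
the perturbed energy (`e` is not below the whole coupled frame). -/
theorem exists_level_below (h : IsSecularEigenpair ε p lam e w) (hne : ∀ k, ε k ≠ e)
    (hpw : p ⬝ᵥ w ≠ 0) (hlam : 0 < lam) : ∃ k, p k ≠ 0 ∧ ε k < e := by
  by_contra hcon
  push Not at hcon
  have hle : ∑ k, p k ^ 2 / (e - ε k) ≤ 0 := by
    refine Finset.sum_nonpos fun k _ => ?_
    by_cases hp : p k = 0
    · simp [hp]
    · have hlt : e - ε k < 0 := sub_neg.mpr (lt_of_le_of_ne (hcon k hp) (fun h' => hne k h'.symm))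
      exact div_nonpos_iff.mpr (Or.inl ⟨sq_nonneg _, hlt.le⟩)
  have hsec := secular_equation h hne hpw
  nlinarith [hle, hlam]

end Summit.RiemannHypothesis.RiemannHypothesis.Theorems.PfPersistence.SecularLaw
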